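import Summits.ABC.IUTFork.Joshi.TestATS4HullGainQuantitative
import Summits.ABC.IUTFork.Cor312RegimeVerbatimPrVolExactRamified
import HarnessLib

/-!
# R-J census, row Y-21ℓ — the ramified hull gain made QUANTITATIVE, II: the trivial ideles —
# `PN_i[Pr(v,…,v)·(i+1)(e−1)/e]·log p ≤ −|log(Θ)|(𝟙)`, and `((e−1)/e)·((ℓ⋆+1)/2)·log p ≤ −|log(Θ)|(𝟙)` when `v` is the only place over `p`

Proof-only record file of the abc-iut cell, branch E → R-J «Joshi Y-discharge census» (D-0079; rung LADDER-ABC:A2.RESCUE.J; seat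
abc-iut-E-t59, gen 9; sequel of this seat's p463394 `TestATS4LowerBoundGenuineConverse` / p464724 `…ConverseWitness`, whose HONEST
SCOPE left open the window question for `q`-ideles REALISING `P_q`: «is `ℓ⋆·(−|log(Θ)|(𝟙))` at least the `q`-granularity
`log p`?» — undecided in the tree without a QUANTITATIVE form of abc-iut-c312-5's ramified hull gain). **No side is taken** on
[IUTchIII] Cor. 3.12 / [IUTchIV] Thm 1.10 or on any author; typed ≠ proved ≠ endorsed; no definition, no `Prop` fact, no instance.

Sequel of `TestATS4HullGainQuantitative` (part I: for arbitrary non-zero pilot ideles, every prime `p`, every label `i+1` and every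
place `v | p` with `e := e_v ≥ 2`, `μ^log_{Pr}((Ind3)-region_{i+1,p}) + Pr(v,…,v)·((i+1)(e−1)/e)·log p ≤ −|log(Θ)|_{i+1,p}` —
abc-iut-c312-5's mover with the OPTIMAL `p`-power). THIS FILE specialises to the trivial configuration `𝟙`:
* §2 `gain_le_thetaLocal_settingPrVolSharp_trivial` / **`processionNormalized_gain_le_negLogTheta_settingPrVolSharp_trivial`** — for
  the TRIVIAL ideles `𝟙` (unit boxes, region volume `0`): `Pr(v,…,v)·((i+1)(e−1)/e)·log p ≤ −|log(Θ)|_{i+1,p}(𝟙)` and, summing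
  (`0 ≤` every other local term, abc-iut-w4-d107 part 13 `thetaLocal_untopD_settingPrVolSharp_trivial_nonneg`), `PN_i[Pr(v,…,v)_{i+1}·(i+1)(e−1)/e]·log p ≤ −|log(Θ)|(𝟙)`;
* §3 **`gain_le_negLogTheta_settingPrVolSharp_trivial_of_unique`** — if `v` is the ONLY place of `F` over `p` (so every
  `Pr(v,…,v) = 1`): `((e−1)/e)·((ℓ⋆+1)/2)·log p ≤ −|log(Θ)|(𝟙)`.
So the inflation window `(0, −|log(Θ)|(𝟙)]` of p463394 has an EXPLICIT length bound from below; the sequel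
`TestATS4LowerBoundGenuineRealising` uses it to place REALISING genuine data inside the window. HONEST SCOPE: Dupuy–Hilado's (Ind2) as
typed at the real setting (`Real.ismDH`: all shell-preserving lattice automorphisms — under a smaller Ism the movers may be absent);
sharp (Ind3) reading; trivial archimedean container; nothing asserted about [IUTchIII] Cor. 3.12 for initial Θ-data.
[cite: DupuyHilado2025, §3.6, §3.9, §4.9] [cite: NeukirchANT1999, Ch. II Prop. (5.5), Prop. (6.8)]
[cite: Mochizuki2012, IUTchIV Thm 1.10 proof Step (v) p. 27–28] [claim: Mochizuki2012, status: disputed]. Standard axioms.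
-/

noncomputable section

open Set Function NumberField IsDedekindDomain Metric
open scoped Pointwise

namespace Summit.ABC.IUTFork.Joshi

open Thm311 Thm311.Real Cor312 Cor312.Setting Cor312Vol Literature.IUT.LogThetaLattice Literature.IUT.LogVolume
  Literature.NumberTheory.NumberFields

namespace TestATS4HullGain

variable {F : Type} [Field F] [NumberField F] (X : PilotData F) {logv : PadicLogs F} (hlog : LogvAnalytic logv)

variable (M : Type) [Field M] [NumberField M]
  (archPk : ∀ (j : (thetaIndex X).Label) (vQ : (thetaIndex X).VQ), Set ((logShellsDH X logv).Packet j vQ))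
  (archSub : ∀ (j : (thetaIndex X).Label) (v : (thetaIndex X).V),
    Set ((logShellsDH X logv).Packet j ((thetaIndex X).over v)))
  (Ψ : ℤ → ∀ v : (thetaIndex X).V, v ∈ (thetaIndex X).Vbad → Set ((logShellsDH X logv).StarPacket v))
  (act : ℤ → ∀ v : (thetaIndex X).V, v ∈ (thetaIndex X).Vbad →
    (logShellsDH X logv).StarPacket v → Module.End ℚ ((logShellsDH X logv).StarPacket v))
  (Mmod : ℤ → ∀ j : (thetaIndex X).LabelStar, Set ((logShellsDH X logv).GlobalPacket j.1))
  (region : ℤ → ∀ j : (thetaIndex X).LabelStar, FinDivisor M → ∀ vQ : (thetaIndex X).VQ,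
    Set ((logShellsDH X logv).Packet j.1 vQ))
  (n : ℤ)
  (t : ∀ (pp : Nat.Primes) (_ : Fin X.lstar) (x : (thetaIndex X).Fibre (.inr pp)),
    haveI : Fact (pp : ℕ).Prime := ⟨pp.2⟩; kOf X pp.1 x)
  (tq : ∀ (pp : Nat.Primes) (x : (thetaIndex X).Fibre (.inr pp)),
    haveI : Fact (pp : ℕ).Prime := ⟨pp.2⟩; kOf X pp.1 x)
  {HT : Type} {LogLink : HT → HT → Type} {IsFull : ∀ {s t : HT}, LogLink s t → Prop}
  (lat : LGPGaussianLogThetaLattice LogLink IsFull)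
  {Frd : Type} {IsoF : Frd → Frd → Type} {Ob : Frd → Type} {realify : Frd → Frd} {Strip : Type}
  {IsoS : Strip → Strip → Type} {Mv : ∀ v : (thetaIndex X).V, v ∈ (thetaIndex X).Vbad → Type}
  [∀ v h, Monoid (Mv v h)]
  (sig : GlobalLGPFrobenioidSignature (thetaIndex X).lstar (thetaIndex X).V (· ∈ (thetaIndex X).Vbad)
    Frd IsoF Ob realify Strip IsoS Mv)
  (split : SplittingMonoids Mv) {ObΔ : Type} {N : ∀ v : (thetaIndex X).V, v ∈ (thetaIndex X).Vbad → Type}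
  [∀ v h, Monoid (N v h)] (qData : QPilotData ObΔ N)

/-! ## 2. The trivial ideles `𝟙`: the gain alone bounds `−|log(Θ)|_{i+1,p}(𝟙)` and `−|log(Θ)|(𝟙)` from below -/

/-- **`Pr(v,…,v)·((i+1)(e−1)/e)·log p ≤ −|log(Θ)|_{i+1,p}(𝟙)`**: for the TRIVIAL ideles (every Θ-box the unit polydisc, every
(Ind3)-region of log-volume `0`: abc-iut-c312-7 `logvol_thetaRegion3_sharp_Pr_inr`) the local Θ-volume at a packet over a place `v | p`
with `e_v ≥ 2` is at least the gain of §1 — the QUANTITATIVE form of abc-iut-w4-d107 part 18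
`thetaLocal_settingPrVolSharp_trivial_pos_of_two_le_ramificationIdx`. [cite: DupuyHilado2025, §3.9, §4.9] [claim: Mochizuki2012, status: disputed] -/
theorem gain_le_thetaLocal_settingPrVolSharp_trivial (i : Fin (thetaIndex X).lstar) (pp : Nat.Primes) [Fact (pp : ℕ).Prime]
    (v : HeightOneSpectrum (𝓞 F)) (hv : (thetaIndex X).over (.inr v) = .inr pp)
    (hvp : ((pp : ℕ) : 𝓞 F) ∈ v.asIdeal) (he : 2 ≤ absRamificationIdx (pp : ℕ) (RescaledCompletion F (pp : ℕ) v hvp)) :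
    ((weightPr X pp.1 (Setting.labelSucc i) (fun _ => ⟨.inr v, hv⟩) *
          ((((i : ℕ) : ℝ) + 1) * ((absRamificationIdx (pp : ℕ) (RescaledCompletion F (pp : ℕ) v hvp) : ℝ) - 1) /
            (absRamificationIdx (pp : ℕ) (RescaledCompletion F (pp : ℕ) v hvp) : ℝ) * Real.log (pp : ℕ)) : ℝ) : WithTop ℝ) ≤
      (settingPrVolSharp X hlog M archPk archSub Ψ act Mmod region n lat sig split qData (fun _ _ => 1) (fun _ _ _ => 1)
        (fun _ _ => one_ne_zero) (fun _ _ _ => norm_one)).thetaLocal (Setting.labelSucc i) (.inr pp) := by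
  have h := logvol_thetaRegion3_add_gain_le_thetaLocal_settingPrVolSharp X hlog M archPk archSub Ψ act Mmod region n
    (fun _ _ _ => 1) (fun _ _ => 1) lat sig split qData (fun _ _ _ => one_ne_zero) (fun _ _ _ _ => norm_one)
    (fun _ _ => one_ne_zero) (fun _ _ _ => norm_one) i pp v hv hvp he
  have hval : ((situationPrVol X hlog M archPk archSub Ψ act Mmod region).D n).logvol (Setting.labelSucc i) (.inr pp)
      ((settingPrVolSharp X hlog M archPk archSub Ψ act Mmod region n lat sig split qData (fun _ _ => 1) (fun _ _ _ => 1)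
        (fun _ _ => one_ne_zero) (fun _ _ _ => norm_one)).thetaRegion3 (Setting.labelSucc i) (.inr pp)) =
      ∑ e : (presAt X hlog pp).toLocalPieces.E (Setting.labelSucc i),
        weightPr X pp.1 (Setting.labelSucc i) e *
          Real.log ‖(fun (_ : Nat.Primes) (_ : Fin X.lstar) (x : (thetaIndex X).Fibre (.inr pp)) =>
            (1 : kOf X pp.1 x)) pp i (e (Fin.last _))‖ :=
    logvol_thetaRegion3_sharp_Pr_inr X hlog M archPk archSub Ψ act Mmod region n lat sig split qData
      (fun _ => qCentreDH X hlog (fun _ _ => 1)) (qCentreDH_ne_zero X hlog (fun _ _ => 1) (fun _ _ => one_ne_zero))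
      (finite_support_logvol_qRegion_Pr X hlog M archPk archSub Ψ act Mmod region n (fun _ _ => 1) (fun _ _ => one_ne_zero)
        (fun _ _ _ => norm_one)) (fun _ _ _ => 1) (fun _ _ _ => one_ne_zero) i pp
  have h0 : ∑ e : (presAt X hlog pp).toLocalPieces.E (Setting.labelSucc i),
        weightPr X pp.1 (Setting.labelSucc i) e *
          Real.log ‖(fun (_ : Nat.Primes) (_ : Fin X.lstar) (x : (thetaIndex X).Fibre (.inr pp)) =>
            (1 : kOf X pp.1 x)) pp i (e (Fin.last _))‖ = 0 :=
    Finset.sum_eq_zero fun e _ => by rw [norm_one, Real.log_one, mul_zero]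
  rw [hval, h0, zero_add] at h
  exact h

/-- **`PN_i[Pr(v,…,v)_{i+1}·((i+1)(e−1)/e)]·log p ≤ −|log(Θ)|(𝟙)`**: the procession-normalised sum of the local gains at the packets
over ONE place `v | p` with `e := e_v ≥ 2` bounds the Θ-volume of the trivial configuration from below (every other local term
is `≥ 0`). No hypothesis on `S`. [cite: DupuyHilado2025, §3.9, §4.9] [claim: Mochizuki2012, status: disputed] -/
theorem processionNormalized_gain_le_negLogTheta_settingPrVolSharp_trivial (pp : Nat.Primes) [Fact (pp : ℕ).Prime]
    (v : HeightOneSpectrum (𝓞 F)) (hv : (thetaIndex X).over (.inr v) = .inr pp)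
    (hvp : ((pp : ℕ) : 𝓞 F) ∈ v.asIdeal) (he : 2 ≤ absRamificationIdx (pp : ℕ) (RescaledCompletion F (pp : ℕ) v hvp)) :
    ((processionNormalized (fun i : Fin (thetaIndex X).lstar =>
        weightPr X pp.1 (Setting.labelSucc i) (fun _ => ⟨.inr v, hv⟩) *
          ((((i : ℕ) : ℝ) + 1) * ((absRamificationIdx (pp : ℕ) (RescaledCompletion F (pp : ℕ) v hvp) : ℝ) - 1) /
            (absRamificationIdx (pp : ℕ) (RescaledCompletion F (pp : ℕ) v hvp) : ℝ) * Real.log (pp : ℕ))) : ℝ) : WithTop ℝ) ≤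
      (settingPrVolSharp X hlog M archPk archSub Ψ act Mmod region n lat sig split qData (fun _ _ => 1) (fun _ _ _ => 1)
        (fun _ _ => one_ne_zero) (fun _ _ _ => norm_one)).negLogTheta := by
  have hfinΘ₁ := thetaFinite_settingPrVolSharp X hlog M archPk archSub Ψ act Mmod region n lat sig split qData
    (fun _ _ _ => 1) (fun _ _ => 1) (fun _ _ _ => one_ne_zero) (fun _ _ _ _ => norm_one) (fun _ _ => one_ne_zero)
    (fun _ _ _ => norm_one)
  have hnn := thetaLocal_untopD_settingPrVolSharp_trivial_nonneg X hlog M archPk archSub Ψ act Mmod region n lat sig split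
    qData
  have hloc : ∀ i : Fin (thetaIndex X).lstar,
      weightPr X pp.1 (Setting.labelSucc i) (fun _ => ⟨.inr v, hv⟩) *
          ((((i : ℕ) : ℝ) + 1) * ((absRamificationIdx (pp : ℕ) (RescaledCompletion F (pp : ℕ) v hvp) : ℝ) - 1) /
            (absRamificationIdx (pp : ℕ) (RescaledCompletion F (pp : ℕ) v hvp) : ℝ) * Real.log (pp : ℕ)) ≤
        ((settingPrVolSharp X hlog M archPk archSub Ψ act Mmod region n lat sig split qData (fun _ _ => 1) (fun _ _ _ => 1)
          (fun _ _ => one_ne_zero) (fun _ _ _ => norm_one)).thetaLocal (Setting.labelSucc i) (.inr pp)).untopD 0 := by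
    intro i
    have h := gain_le_thetaLocal_settingPrVolSharp_trivial X hlog M archPk archSub Ψ act Mmod region n lat sig split qData i pp
      v hv hvp he
    obtain ⟨r, hr⟩ := WithTop.ne_top_iff_exists.mp (hfinΘ₁.1 i (.inr pp))
    rw [← hr, WithTop.coe_le_coe] at h
    rw [← hr, WithTop.untopD_coe]
    exact h
  unfold Setting.negLogTheta
  rw [if_pos hfinΘ₁]
  refine WithTop.coe_le_coe.mpr ?_
  unfold processionNormalized
  exact div_le_div_of_nonneg_right (Finset.sum_le_sum fun i _ =>
    (hloc i).trans (single_le_finsum (Sum.inr pp) (hfinΘ₁.2 i) (hnn i))) (Nat.cast_nonneg _)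

/-! ## 3. A prime with ONE place above it: `((e−1)/e)·((ℓ⋆+1)/2)·log p ≤ −|log(Θ)|(𝟙)` -/

/-- Plumbing: `Σ_{i<n} (i+1) = n(n+1)/2` over `ℝ`. [folklore] -/
theorem sum_fin_val_add_one (m : ℕ) : ∑ i : Fin m, (((i : ℕ) : ℝ) + 1) = (m : ℝ) * (m + 1) / 2 := by
  rw [Fin.sum_univ_eq_sum_range (fun i => ((i : ℝ) + 1)) m]
  induction m with
  | zero => simp
  | succ m ih =>
    rw [Finset.sum_range_succ, ih]
    push_cast
    ring

/-- If `v` is the only place of `F` over `p`, every element of the fibre of the index over `p` is `v`. [folklore] -/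
theorem fibre_eq_of_unique (pp : Nat.Primes) [Fact (pp : ℕ).Prime] (v : HeightOneSpectrum (𝓞 F))
    (hv : (thetaIndex X).over (.inr v) = .inr pp)
    (huniq : ∀ w ∈ placesOver F pp, w = v) (x : (thetaIndex X).Fibre (.inr pp)) :
    x = ⟨.inr v, hv⟩ := by
  apply (fibreEquivPlacesOver X pp).injective
  exact Subtype.ext (huniq _ (placeOf_mem X pp.1 x))

include hlog in
/-- With ONE place over `p`, every diagonal weight is `Pr(v,…,v) = 1` (the weights over the tuples sum to `1`, abc-iut-c312-5
`sum_weightPr_presAt`, and there is only the diagonal tuple). [cite: DupuyHilado2025, §3.6] -/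
theorem weightPr_eq_one_of_unique (pp : Nat.Primes) [Fact (pp : ℕ).Prime] (v : HeightOneSpectrum (𝓞 F))
    (hv : (thetaIndex X).over (.inr v) = .inr pp)
    (huniq : ∀ w ∈ placesOver F pp, w = v) (j : (thetaIndex X).Label) :
    weightPr X pp.1 j (fun _ => ⟨.inr v, hv⟩) = 1 := by
  have hsum := sum_weightPr_presAt X hlog pp j
  have hall : ∀ e : (presAt X hlog pp).toLocalPieces.E j, e = fun _ => ⟨.inr v, hv⟩ :=
    fun e => funext fun a => fibre_eq_of_unique X pp v hv huniq (e a)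
  have h2 : ∑ e : (presAt X hlog pp).toLocalPieces.E j, weightPr X pp.1 j e =
      weightPr X pp.1 j ((fun _ => ⟨.inr v, hv⟩ : (presAt X hlog pp).toLocalPieces.E j)) :=
    Finset.sum_eq_single _ (fun e _ hne => absurd (hall e) hne) (fun h => absurd (Finset.mem_univ _) h)
  rw [h2] at hsum
  exact hsum

/-- **`((e−1)/e)·((ℓ⋆+1)/2)·log p ≤ −|log(Θ)|(𝟙)` when `v` is the ONLY place of `F` over `p` and `e := e_v ≥ 2`** (e.g. a prime
totally ramified in `F`): every diagonal weight is `1` and `PN_i(i+1) = (ℓ⋆+1)/2`. This is the explicit lower bound on the length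
of p463394's inflation window `(0, −|log(Θ)|(𝟙)]` that the REALISING countermodel of the sequel needs. No hypothesis on `S`.
[cite: DupuyHilado2025, §3.6, §3.9, §4.9] [cite: NeukirchANT1999, Ch. II Prop. (6.8)] [claim: Mochizuki2012, status: disputed] -/
theorem gain_le_negLogTheta_settingPrVolSharp_trivial_of_unique (pp : Nat.Primes) [Fact (pp : ℕ).Prime]
    (v : HeightOneSpectrum (𝓞 F)) (hv : (thetaIndex X).over (.inr v) = .inr pp)
    (hvp : ((pp : ℕ) : 𝓞 F) ∈ v.asIdeal) (he : 2 ≤ absRamificationIdx (pp : ℕ) (RescaledCompletion F (pp : ℕ) v hvp))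
    (huniq : ∀ w ∈ placesOver F pp, w = v) :
    (((((absRamificationIdx (pp : ℕ) (RescaledCompletion F (pp : ℕ) v hvp) : ℝ) - 1) /
            (absRamificationIdx (pp : ℕ) (RescaledCompletion F (pp : ℕ) v hvp) : ℝ)) *
          ((((thetaIndex X).lstar : ℝ) + 1) / 2) * Real.log (pp : ℕ) : ℝ) : WithTop ℝ) ≤
      (settingPrVolSharp X hlog M archPk archSub Ψ act Mmod region n lat sig split qData (fun _ _ => 1) (fun _ _ _ => 1)
        (fun _ _ => one_ne_zero) (fun _ _ _ => norm_one)).negLogTheta := by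
  have h := processionNormalized_gain_le_negLogTheta_settingPrVolSharp_trivial X hlog M archPk archSub Ψ act Mmod region n lat
    sig split qData pp v hv hvp he
  have hl : (0 : ℝ) < (thetaIndex X).lstar := by exact_mod_cast lt_of_lt_of_le two_pos (thetaIndex X).two_le_lstar
  have key : processionNormalized (fun i : Fin (thetaIndex X).lstar =>
        weightPr X pp.1 (Setting.labelSucc i) (fun _ => ⟨.inr v, hv⟩) *
          ((((i : ℕ) : ℝ) + 1) * ((absRamificationIdx (pp : ℕ) (RescaledCompletion F (pp : ℕ) v hvp) : ℝ) - 1) /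
            (absRamificationIdx (pp : ℕ) (RescaledCompletion F (pp : ℕ) v hvp) : ℝ) * Real.log (pp : ℕ))) =
      (((absRamificationIdx (pp : ℕ) (RescaledCompletion F (pp : ℕ) v hvp) : ℝ) - 1) /
            (absRamificationIdx (pp : ℕ) (RescaledCompletion F (pp : ℕ) v hvp) : ℝ)) *
          ((((thetaIndex X).lstar : ℝ) + 1) / 2) * Real.log (pp : ℕ) := by
    simp_rw [weightPr_eq_one_of_unique X hlog pp v hv huniq, one_mul]
    unfold processionNormalized
    have hre : ∀ i : Fin (thetaIndex X).lstar,
        (((i : ℕ) : ℝ) + 1) * ((absRamificationIdx (pp : ℕ) (RescaledCompletion F (pp : ℕ) v hvp) : ℝ) - 1) /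
            (absRamificationIdx (pp : ℕ) (RescaledCompletion F (pp : ℕ) v hvp) : ℝ) * Real.log (pp : ℕ) =
          (((i : ℕ) : ℝ) + 1) * ((((absRamificationIdx (pp : ℕ) (RescaledCompletion F (pp : ℕ) v hvp) : ℝ) - 1) /
            (absRamificationIdx (pp : ℕ) (RescaledCompletion F (pp : ℕ) v hvp) : ℝ)) * Real.log (pp : ℕ)) := fun i => by ring
    simp_rw [hre]
    rw [← Finset.sum_mul, sum_fin_val_add_one]
    field_simp
  rw [key] at h
  exact h

end TestATS4HullGain

end Summit.ABC.IUTFork.Joshi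

end
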